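import Summits.AtomisticToContinuum.HydrodynamicLimit.Theorems.JParityClosureLocalSecondLawLedgerObsCont

/-!
# Pinned cells: uniform continuity of the crux integrand around the regular range
(crux `JParityClosure.LocalSecondLaw`, stmt-AtomisticToContinuum-13081, line `contact-asymmetry-information`,
stub Q `stub_pinnedRepresentation` — deterministic layer, no measure theory)

The crux integrand `H(ρ, θ(ρ, m, e)) (a + (m/ρ)·b)` as a function of the conserved variables `p = (ρ, m, e)`
(with the test-function data `a = ∂ₛφ`, `b = ∇φ` bounded by `A`) is LIPSCHITZ and BOUNDED on a compact convex box
around the REGULAR-PLUS range `c₀ ≤ ρ`, `ρσ³ ≤ η₁`, `c₀ ≤ θ`, `0 ≤ e ≤ Ē` (floors, packing cap inside the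
equation-of-state band, AND an energy cap — without the energy cap the velocity `m/ρ` and the entropy of hot
states make the integrand fail to be uniformly continuous), uniformly at a positive scale `δ₀`: every `q` within
`δ₀` of a regular-plus `p` lies in the neighbourhood `regNbhd` where the smooth modification `Ĥ` of the entropy
density IS the entropy density, and `|Γ(p) − Γ(q)| ≤ L · dist p q`, `|Γ(p)|, |Γ(q)| ≤ C`
(`pinQ_uniform_package`).  This is the deterministic content of stub Q on the regular range: a member of a
pinned cell and the mean fields of the cell are within `2η′` of each other, so their integrands differ by
`≤ 2Lη′` pointwise.  Also: the crux integrand of a regular configuration is `Γ` of its conserved fields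
(`pinQ_integrand_eq_of_regular`), and `H(q₁, θ(q)) = Ĥ(q)` near the regular range (`pinQ_Hs_eq_Hhat`).

References: H. B. Callen, *Thermodynamics* (2nd ed. 1985) §1.9–2.3 (smoothness of the fundamental relation away
from the degenerate states); the smooth modification `Ĥ` is `Theorems/JParityClosureLocalSecondLawLedgerHhat.lean`.
-/

noncomputable section

open scoped BigOperators Topology Classical ENNReal InnerProductSpace NNReal
open Filter Set Function
open Literature.MathematicalPhysics.KineticTheory
open Literature.Analysis.FluidPDE
open Summit.AtomisticToContinuum.HydrodynamicLimit.Theorems.LocalSecondLawNegative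
open Summit.AtomisticToContinuum.HydrodynamicLimit.Theorems.LocalSecondLawLedger

namespace Summit.AtomisticToContinuum.HydrodynamicLimit.Theorems.LocalSecondLawContact

section PinnedBox

open Summit.AtomisticToContinuum.HydrodynamicLimit.Theorems.LocalSecondLawLedger.L

variable {N : ℕ}

/-! ## Elementary bounds on the regular-plus range -/

/-- On the regular-plus range the momentum components are bounded: `c₀ ≤ θ(ρ, m, e)` with `0 < ρ ≤ R`, `0 ≤ e ≤ Ē`
forces `|m_k| ≤ √(2 R Ē)`. -/
theorem pinQ_abs_mom_le {c₀ R Ē ρ e : ℝ} {m : Fin 3 → ℝ} (hc : 0 < c₀) (hρ : 0 < ρ) (hρR : ρ ≤ R) (he : 0 ≤ e)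
    (heE : e ≤ Ē) (hθ : c₀ ≤ thetaOf ρ e m) (k : Fin 3) : |m k| ≤ Real.sqrt (2 * R * Ē) := by
  refine Real.abs_le_sqrt ?_
  have hS : m k ^ 2 ≤ ∑ l, m l ^ 2 :=
    Finset.single_le_sum (f := fun l => m l ^ 2) (fun l _ => sq_nonneg _) (Finset.mem_univ k)
  have hpos : 0 < e / ρ - (∑ l, m l ^ 2) / (2 * ρ ^ 2) := by
    have : c₀ ≤ 2 / 3 * (e / ρ - (∑ l, m l ^ 2) / (2 * ρ ^ 2)) := hθ
    nlinarith
  have h1 : (∑ l, m l ^ 2) / (2 * ρ ^ 2) < e / ρ := by linarith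
  rw [div_lt_div_iff₀ (by positivity) hρ] at h1
  have h2 : (∑ l, m l ^ 2) < 2 * ρ * e := by nlinarith
  have h3 : 2 * ρ * e ≤ 2 * R * Ē := by
    have := mul_le_mul hρR heE he (hρ.le.trans hρR)
    nlinarith
  linarith

/-- The sup distance on the conserved variables controls each coordinate. -/
theorem pinQ_dist_coords {p q : CV} {δ : ℝ} (h : dist p q ≤ δ) :
    |p.1 - q.1| ≤ δ ∧ (∀ k, |p.2.1 k - q.2.1 k| ≤ δ) ∧ |p.2.2 - q.2.2| ≤ δ := by
  have hδ : 0 ≤ δ := dist_nonneg.trans h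
  rw [Prod.dist_eq, max_le_iff, Prod.dist_eq, max_le_iff] at h
  obtain ⟨h1, h2, h3⟩ := h
  refine ⟨by rwa [← Real.dist_eq], fun k => ?_, by rwa [← Real.dist_eq]⟩
  rw [← Real.dist_eq]
  exact (dist_le_pi_dist _ _ k).trans h2

/-! ## The uniform continuity package -/

section Package

variable {σ c₀ η₀ η₁ : ℝ} {F : ℝ → ℝ} (hE : EosBand η₀ F) (hσ : 0 < σ) (hc : 0 < c₀) (hη : 0 < η₁) (hη₁ : η₁ < η₀)

include hη₁ hc in
/-- Near the regular range the guarded entropy of `(q₁, θ(q))` is the smooth modification `Ĥ(q)`. -/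
theorem pinQ_Hs_eq_Hhat {q : CV} (hq : q ∈ regNbhd σ c₀ η₀ η₁) :
    Hs σ q.1 (thetaOf q.1 q.2.2 q.2.1) = Hhat σ c₀ η₀ η₁ q := by
  obtain ⟨h1, h2, -⟩ := id hq
  rw [Hhat_eq_Hsm hη₁ hc hq, Hs_eq_Hsm (by linarith) (by linarith)]

include hη₁ hc in
/-- **The crux integrand of a regular configuration is `Γ` of its conserved fields.** -/
theorem pinQ_integrand_eq_of_regular {r : ℝ} {w : Phase N}
    (hreg : ∀ x, c₀ ≤ rhoC r w x ∧ rhoC r w x * σ ^ 3 ≤ η₁ ∧ c₀ ≤ thetaC r w x) (x : T3) (a : ℝ) (b : Fin 3 → ℝ) :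
    Hs σ (rhoC r w x) (thetaC r w x) * (a + ∑ k, momC r w x k / rhoC r w x * b k) =
      Hhat σ c₀ η₀ η₁ (U r w x) * (a + ∑ k, (U r w x).2.1 k / (U r w x).1 * b k) := by
  rw [Hhat_U_eq_Hs hη₁ hc hreg]
  rfl

include hE hσ hc hη hη₁ in
/-- **Uniform continuity package of the crux integrand around the regular-plus range.**  For the data
`σ, c₀, η₁ < η₀` (band), an energy cap `Ē` and a bound `A` on the test-function data there are a scale `δ₀ > 0`, a
Lipschitz constant `L` and a bound `C` such that: whenever `p` is regular-plus (`c₀ ≤ ρ`, `ρσ³ ≤ η₁`, `c₀ ≤ θ(p)`,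
`0 ≤ e ≤ Ē`) and `dist p q ≤ δ₀`, then `q` (and `p`) lie in the neighbourhood `regNbhd` of the regular range with
positive density and temperature, and for all `|a| ≤ A`, `|b_k| ≤ A` the integrand
`Γ(p) = Ĥ(p)(a + ∑ₖ (m_k/ρ) b_k)` satisfies `|Γ p − Γ q| ≤ L · dist p q` and `|Γ p|, |Γ q| ≤ C`. -/
theorem pinQ_uniform_package (Ē A : ℝ) :
    ∃ δ₀ : ℝ, 0 < δ₀ ∧ ∃ L C : ℝ, 0 ≤ L ∧ ∀ p q : CV,
      c₀ ≤ p.1 → p.1 * σ ^ 3 ≤ η₁ → c₀ ≤ thetaOf p.1 p.2.2 p.2.1 → 0 ≤ p.2.2 → p.2.2 ≤ Ē → dist p q ≤ δ₀ →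
        (q ∈ regNbhd σ c₀ η₀ η₁ ∧ 0 < q.1 ∧ 0 < thetaOf q.1 q.2.2 q.2.1) ∧
        (p ∈ regNbhd σ c₀ η₀ η₁ ∧ 0 < p.1 ∧ 0 < thetaOf p.1 p.2.2 p.2.1) ∧
        ∀ (a : ℝ) (b : Fin 3 → ℝ), |a| ≤ A → (∀ k, |b k| ≤ A) →
          |Hhat σ c₀ η₀ η₁ p * (a + ∑ k, p.2.1 k / p.1 * b k) - Hhat σ c₀ η₀ η₁ q * (a + ∑ k, q.2.1 k / q.1 * b k)|
              ≤ L * dist p q ∧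
            |Hhat σ c₀ η₀ η₁ p * (a + ∑ k, p.2.1 k / p.1 * b k)| ≤ C ∧
            |Hhat σ c₀ η₀ η₁ q * (a + ∑ k, q.2.1 k / q.1 * b k)| ≤ C := by
  -- the box
  set R : ℝ := η₁ / σ ^ 3 with hR
  set M : ℝ := Real.sqrt (2 * R * Ē) + 1 with hM
  have hσ3 : 0 < σ ^ 3 := by positivity
  have hR0 : 0 < R := div_pos hη hσ3
  have hM1 : 1 ≤ M := by have := Real.sqrt_nonneg (2 * R * Ē); linarith
  set B : Set CV := Set.Icc (c₀ / 2) (R + 1) ×ˢ ((Set.univ.pi fun _ : Fin 3 => Set.Icc (-M) M) ×ˢ Set.Icc (-1) (Ē + 1))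
    with hB
  have hBc : IsCompact B :=
    isCompact_Icc.prod ((isCompact_univ_pi fun _ => isCompact_Icc).prod isCompact_Icc)
  have hBconv : Convex ℝ B :=
    (convex_Icc _ _).prod ((convex_pi fun _ _ => convex_Icc _ _).prod (convex_Icc _ _))
  have hBρ : ∀ q ∈ B, c₀ / 2 ≤ q.1 := fun q hq => by
    rw [hB, Set.mem_prod] at hq; exact hq.1.1
  -- membership: regular-plus points, and points near them
  have hmemP : ∀ p : CV, c₀ ≤ p.1 → p.1 * σ ^ 3 ≤ η₁ → c₀ ≤ thetaOf p.1 p.2.2 p.2.1 → 0 ≤ p.2.2 → p.2.2 ≤ Ē →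
      p.1 ≤ R ∧ ∀ k, |p.2.1 k| ≤ M - 1 := by
    intro p h1 h2 h3 h4 h5
    have hρR : p.1 ≤ R := by rw [hR, le_div_iff₀ hσ3]; exact h2
    refine ⟨hρR, fun k => ?_⟩
    have := pinQ_abs_mom_le hc (hc.trans_le h1) hρR h4 h5 h3 k
    rw [hM]; linarith
  have hmemQ : ∀ p q : CV, c₀ ≤ p.1 → p.1 * σ ^ 3 ≤ η₁ → c₀ ≤ thetaOf p.1 p.2.2 p.2.1 → 0 ≤ p.2.2 → p.2.2 ≤ Ē →
      dist p q ≤ min (c₀ / 2) 1 → q ∈ B := by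
    intro p q h1 h2 h3 h4 h5 hd
    obtain ⟨hρR, hm⟩ := hmemP p h1 h2 h3 h4 h5
    obtain ⟨d1, d2, d3⟩ := pinQ_dist_coords hd
    have hmin1 : min (c₀ / 2) 1 ≤ c₀ / 2 := min_le_left _ _
    have hmin2 : min (c₀ / 2) 1 ≤ 1 := min_le_right _ _
    rw [hB, Set.mem_prod, Set.mem_prod, Set.mem_Icc, Set.mem_pi, Set.mem_Icc]
    refine ⟨⟨?_, ?_⟩, fun k _ => ?_, ?_, ?_⟩
    · linarith [(abs_le.1 d1).1, (abs_le.1 d1).2]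
    · linarith [(abs_le.1 d1).1, (abs_le.1 d1).2]
    · rw [Set.mem_Icc]
      have hk := hm k
      have dk := d2 k
      constructor
      · linarith [(abs_le.1 hk).1, (abs_le.1 dk).1, (abs_le.1 dk).2]
      · linarith [(abs_le.1 hk).2, (abs_le.1 dk).1, (abs_le.1 dk).2]
    · linarith [(abs_le.1 d3).1, (abs_le.1 d3).2]
    · linarith [(abs_le.1 d3).1, (abs_le.1 d3).2]
  have hmemPB : ∀ p : CV, c₀ ≤ p.1 → p.1 * σ ^ 3 ≤ η₁ → c₀ ≤ thetaOf p.1 p.2.2 p.2.1 → 0 ≤ p.2.2 → p.2.2 ≤ Ē →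
      p ∈ B := fun p h1 h2 h3 h4 h5 =>
    hmemQ p p h1 h2 h3 h4 h5 (by rw [dist_self]; positivity)
  -- Lipschitz constant of the temperature on the box
  have hθC : ContDiffOn ℝ 1 (fun p : CV => thetaOf p.1 p.2.2 p.2.1) B := by
    have hne : ∀ p ∈ B, (p : CV).1 ≠ 0 := fun p hp => by have := hBρ p hp; intro h; rw [h] at this; linarith
    have h1 : ContDiffOn ℝ 1 (fun p : CV => p.2.2 / p.1) B := (contDiff_snd.comp contDiff_snd).contDiffOn.div
      contDiff_fst.contDiffOn hne
    have h2 : ContDiffOn ℝ 1 (fun p : CV => (∑ k, p.2.1 k ^ 2) / (2 * p.1 ^ 2)) B := by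
      refine ContDiffOn.div ?_ (contDiff_const.mul (contDiff_fst.pow 2)).contDiffOn fun p hp => ?_
      · exact (ContDiff.sum fun k _ => ((contDiff_apply ℝ ℝ k).comp (contDiff_fst.comp contDiff_snd)).pow 2).contDiffOn
      · exact mul_ne_zero two_ne_zero (pow_ne_zero 2 (hne p hp))
    unfold thetaOf
    exact contDiffOn_const.mul (h1.sub h2)
  obtain ⟨Kθ, hKθ⟩ := hθC.exists_lipschitzOnWith one_ne_zero hBconv hBc
  -- Lipschitz constant and bound of the integrand on the big box
  set BB : Set (CV × ℝ × (Fin 3 → ℝ)) :=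
    B ×ˢ (Set.Icc (-A) A ×ˢ Set.univ.pi fun _ : Fin 3 => Set.Icc (-A) A) with hBB
  have hBBc : IsCompact BB := hBc.prod (isCompact_Icc.prod (isCompact_univ_pi fun _ => isCompact_Icc))
  have hBBconv : Convex ℝ BB := hBconv.prod ((convex_Icc _ _).prod (convex_pi fun _ _ => convex_Icc _ _))
  have hG : ContDiffOn ℝ 1 (fun q : CV × ℝ × (Fin 3 → ℝ) =>
      Hhat σ c₀ η₀ η₁ q.1 * (q.2.1 + ∑ k, q.1.2.1 k / q.1.1 * q.2.2 k)) BB := by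
    have hne : ∀ q ∈ BB, (q : CV × ℝ × (Fin 3 → ℝ)).1.1 ≠ 0 := fun q hq => by
      rw [hBB, Set.mem_prod] at hq
      have := hBρ q.1 hq.1; intro h; rw [h] at this; linarith
    have h1 : ContDiffOn ℝ 1 (fun q : CV × ℝ × (Fin 3 → ℝ) => Hhat σ c₀ η₀ η₁ q.1) BB :=
      ((contDiff_Hhat hE hη hη₁ hσ hc).comp contDiff_fst).contDiffOn
    have h2 : ∀ k : Fin 3, ContDiffOn ℝ 1 (fun q : CV × ℝ × (Fin 3 → ℝ) => q.1.2.1 k / q.1.1 * q.2.2 k) BB := by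
      intro k
      refine (ContDiffOn.div ?_ (contDiff_fst.comp contDiff_fst).contDiffOn hne).mul ?_
      · exact ((contDiff_apply ℝ ℝ k).comp (contDiff_fst.comp (contDiff_snd.comp contDiff_fst))).contDiffOn
      · exact ((contDiff_apply ℝ ℝ k).comp (contDiff_snd.comp contDiff_snd)).contDiffOn
    exact h1.mul ((contDiff_fst.comp contDiff_snd).contDiffOn.add (ContDiffOn.sum fun k _ => h2 k))
  obtain ⟨KG, hKG⟩ := hG.exists_lipschitzOnWith one_ne_zero hBBconv hBBc
  obtain ⟨C, hC⟩ := hBBc.exists_bound_of_continuousOn hG.continuousOn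
  -- the scale
  have hgap : 0 < (η₀ - η₁) / 3 := by linarith
  set δ₀ : ℝ := min (min (c₀ / 4) 1) (min ((η₀ - η₁) / (3 * σ ^ 3) / 2) (c₀ / (4 * (Kθ + 1)))) with hδ₀
  have hKθ0 : (0 : ℝ) ≤ Kθ := Kθ.2
  have hδ₀pos : 0 < δ₀ := by positivity
  have hδ₁ : δ₀ ≤ c₀ / 4 := le_trans (min_le_left _ _) (min_le_left _ _)
  have hδ₂ : δ₀ ≤ 1 := le_trans (min_le_left _ _) (min_le_right _ _)
  have hδ₃ : δ₀ ≤ (η₀ - η₁) / (3 * σ ^ 3) / 2 := le_trans (min_le_right _ _) (min_le_left _ _)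
  have hδ₄ : δ₀ ≤ c₀ / (4 * (Kθ + 1)) := le_trans (min_le_right _ _) (min_le_right _ _)
  have hδmin : δ₀ ≤ min (c₀ / 2) 1 := le_min (by linarith) hδ₂
  refine ⟨δ₀, hδ₀pos, KG, C, KG.2, fun p q h1 h2 h3 h4 h5 hd => ?_⟩
  have hpB : p ∈ B := hmemPB p h1 h2 h3 h4 h5
  have hqB : q ∈ B := hmemQ p q h1 h2 h3 h4 h5 (hd.trans hδmin)
  obtain ⟨d1, d2, d3⟩ := pinQ_dist_coords hd
  -- the temperature of q
  have hθq : c₀ / 2 < thetaOf q.1 q.2.2 q.2.1 := by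
    have hL := (lipschitzOnWith_iff_dist_le_mul.1 hKθ) p hpB q hqB
    rw [Real.dist_eq] at hL
    have hKd : (Kθ : ℝ) * dist p q ≤ Kθ * δ₀ := mul_le_mul_of_nonneg_left hd hKθ0
    have hKδ : (Kθ : ℝ) * δ₀ ≤ c₀ / 4 := by
      calc (Kθ : ℝ) * δ₀ ≤ (Kθ + 1) * δ₀ := by nlinarith
        _ ≤ (Kθ + 1) * (c₀ / (4 * (Kθ + 1))) := mul_le_mul_of_nonneg_left hδ₄ (by positivity)
        _ = c₀ / 4 := by field_simp
    have := (abs_le.1 (hL.trans (hKd.trans hKδ))).2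
    linarith
  have hq1 : c₀ / 2 < q.1 := by linarith [(abs_le.1 d1).2]
  have hq3 : q.1 * σ ^ 3 < (2 * η₁ + η₀) / 3 := by
    have hq1' : q.1 ≤ p.1 + δ₀ := by linarith [(abs_le.1 d1).1]
    have : δ₀ * σ ^ 3 ≤ (η₀ - η₁) / 3 / 2 :=
      calc δ₀ * σ ^ 3 ≤ (η₀ - η₁) / (3 * σ ^ 3) / 2 * σ ^ 3 := mul_le_mul_of_nonneg_right hδ₃ hσ3.le
        _ = (η₀ - η₁) / 3 / 2 := by field_simp
    nlinarith
  have hqN : q ∈ regNbhd σ c₀ η₀ η₁ := ⟨hq1, hθq, hq3⟩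
  have hpN : p ∈ regNbhd σ c₀ η₀ η₁ := mem_regNbhd_of_regular hη₁ hc h1 h3 h2
  refine ⟨⟨hqN, by linarith, by linarith⟩, ⟨hpN, by linarith, by linarith⟩, fun a b ha hb => ?_⟩
  have hab : (a, b) ∈ Set.Icc (-A) A ×ˢ Set.univ.pi fun _ : Fin 3 => Set.Icc (-A) A := by
    rw [Set.mem_prod, Set.mem_Icc, Set.mem_pi]
    exact ⟨⟨(abs_le.1 ha).1, (abs_le.1 ha).2⟩, fun k _ => ⟨(abs_le.1 (hb k)).1, (abs_le.1 (hb k)).2⟩⟩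
  have hpBB : ((p, a, b) : CV × ℝ × (Fin 3 → ℝ)) ∈ BB := by rw [hBB, Set.mem_prod]; exact ⟨hpB, hab⟩
  have hqBB : ((q, a, b) : CV × ℝ × (Fin 3 → ℝ)) ∈ BB := by rw [hBB, Set.mem_prod]; exact ⟨hqB, hab⟩
  have hL := (lipschitzOnWith_iff_dist_le_mul.1 hKG) (p, a, b) hpBB (q, a, b) hqBB
  have hdist : dist ((p, a, b) : CV × ℝ × (Fin 3 → ℝ)) (q, a, b) = dist p q := by
    rw [Prod.dist_eq, dist_self, max_eq_left dist_nonneg]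
  rw [Real.dist_eq, hdist] at hL
  have hCp := hC (p, a, b) hpBB
  have hCq := hC (q, a, b) hqBB
  rw [Real.norm_eq_abs] at hCp hCq
  exact ⟨hL, hCp, hCq⟩

end Package

end PinnedBox

/-- **Registered sub-lemma `contactQ_uniform_package` of stub Q** (`stub_pinnedRepresentation`, line
`contact-asymmetry-information`): the uniform continuity package of the crux integrand around the regular-plus range,
in closed form. -/
theorem contactQ_uniform_package : ∀ {σ c₀ η₀ η₁ : ℝ} {F : ℝ → ℝ}, EosBand η₀ F → 0 < σ → 0 < c₀ → 0 < η₁ → η₁ < η₀ → ∀ (Ē A : ℝ), ∃ δ₀ : ℝ, 0 < δ₀ ∧ ∃ Lc C : ℝ, 0 ≤ Lc ∧ ∀ p q : L.CV, c₀ ≤ p.1 → p.1 * σ ^ 3 ≤ η₁ → c₀ ≤ L.thetaOf p.1 p.2.2 p.2.1 → 0 ≤ p.2.2 → p.2.2 ≤ Ē → dist p q ≤ δ₀ → (q ∈ L.regNbhd σ c₀ η₀ η₁ ∧ 0 < q.1 ∧ 0 < L.thetaOf q.1 q.2.2 q.2.1) ∧ (p ∈ L.regNbhd σ c₀ η₀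 η₁ ∧ 0 < p.1 ∧ 0 < L.thetaOf p.1 p.2.2 p.2.1) ∧ ∀ (a : ℝ) (b : Fin 3 → ℝ), |a| ≤ A → (∀ k, |b k| ≤ A) → |L.Hhat σ c₀ η₀ η₁ p * (a + ∑ k, p.2.1 k / p.1 * b k) - L.Hhat σ c₀ η₀ η₁ q * (a + ∑ k, q.2.1 k / q.1 * b k)| ≤ Lc * dist p q ∧ |L.Hhat σ c₀ η₀ η₁ p * (a + ∑ k, p.2.1 k / p.1 * b k)| ≤ C ∧ |L.Hhat σ c₀ η₀ η₁ q * (a + ∑ k, q.2.1 k / q.1 * b k)| ≤ C :=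
  fun hE hσ hc hη hη₁ Ē A => pinQ_uniform_package hE hσ hc hη hη₁ Ē A

end Summit.AtomisticToContinuum.HydrodynamicLimit.Theorems.LocalSecondLawContact

end
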